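import Summits.QuantumFields.YangMills.Theorems.BalabanUVNodesN15TwoSpacingGluingNeumannKnitEntryOne
import Summits.QuantumFields.YangMills.Theorems.BalabanUVNodesN15TwoSpacingGluingDirichlet
import HarnessLib

/-!
# THE GLUING STEP AT TWO LATTICE SPACINGS, XLIV: ENTRY 3 OF THE COVER's PARAMETRIX ON THE DOUBLED TORUS — `(Σ_μ∇′*_μ∇′_μ)∘G₀′` DECAYS, FROM THE EXACT PER-CUBE LOCALITY AND
# dag-n15-a's CUT CUBE ROWS (dag-n15-c g13, FILE 86; N15 = NE2, s1 «background-layer OPERATOR ingredient»)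

Cell `pub-ymgap`, seat `pub-ymgap-dag-n15-c` (R134 (a); HUMAN RULING D-0062), generation 13.  `bears_on: R4∕N15 · K3⁷ SpineGivenEndpointR13SepCoPH (stmt-QuantumFields-20544)`.
Filed `--supports stmt-QuantumFields-20544 --as helper` — COUNT-NEUTRAL.  Theorems only (0 `def`, 0 `sorry`).  Imports BY NAME FILE 84 (through it FILE 83's cut-row editions, FILE 80,
FILES 66–79 and dag-n15-a's PROGRAMME N) and FILE 47 (`hasMaj_localize_sandwich`); nothing in the tree is modified.

WHAT.  Doubled torus `M = MP (paramsOf d L (m+1) k hL)`, FILE 70's cover (cubes of side `L·L^m`, Neumann propagators `knitG`, partition `knitH`), the local Laplacian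
`D₃ = lapOp n (bshiftEquiv) 0 = Σ_μ∇*_μ∇_μ = Δ_a − N_L` (FILE 69 `deltaOp_eq_lapOp_zero_add`; = `ρ(sLap)` by FILE 62), at the fine spacing `n′ = L^r·L^k` (blocks through the pairing).
* §1 ★ `hasMaj_mulOp_coverH_loc` (the partition multiplier `M_{h_k} ≤ 1_□(y)1_□(y′)·e^{−δd}` for any `δ ≥ 0`: FILE 47 `hasMaj_localize_sandwich`), ★★ `mulOp_coverH_comp_lapOp_comp_knitG`
  (THE ENTRY-3 IDENTITY `M_{h_k}∘D₃∘G(□_k) = M_{h_k} − M_{h_k}∘(M_{χ_□}∘N_L∘G(□_k))` — the exact per-cube locality `M_hΔ_aG(□) = M_h` (N-IIIa) and `M_h = M_hM_χ`), ★★ `hasMaj_mulOp_coverH_lap_knitG`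
  (its two-sided row `1_□1_□(1 + 2^{d+1}c_N(Ce^{δ₀})c_r)e^{−ρd}` from N-IIi `hasMaj_chiCube_comp_neumannCubeG` with `T₁ := N_L` and FILE 69's nonlocal letter);
* §2 ★★★ **`hasMaj_lap_parametrix_knit`** — `∃ δ A > 0 ∀ m k r (k ≥ 1): D₃′∘G₀′ ≤ A·e^{−δ|y−y′|_T}`: FILE 83 `hasMaj_comp_parametrix_of_commOp_h` with §1's weighted rows and FILE 72's
  commutator rows `hasMaj_commOp_lapOp_comp_cover_of` (fed by the fine cut rows N-IIIb, `hasMaj_chiCube_grad_neumannCubeG_fine`, `hasMaj_chiCube_divAdjOut_neumannCubeG_pair`).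
The entry-3 `D₃′∘G₀′` row of FILE 50's `GluedLetters` for the glued `U ≡ 1` family; its two-grid defect is the next file.

HONEST FRAMING ∕ LIMITS.  Block-majorant bookkeeping over LANDED rows at `U ≡ 1` on the doubled-cube torus MODEL (Neumann-by-images cubes); no new analytic estimate.  Nothing of
[B5]∕[B6]∕[B9] asserted ([B6] (2.133)–(2.136) p.247 shapes; [B9] (3.42) p.397 entry 3's shape).  NE2⁺ NOT PRINTED, NOT proved; N15 NOT discharged; counts of record UNMOVED (typed 28∕28
· discharged 5∕27); one finite 𝕋⁴ at fixed ε per index — NOT infinite volume, NOT OS on ℝ⁴, NOT a mass gap, NOT Clay; R4 closes the conditional finite-𝕋⁴ rung `BalabanLadder.UV`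
only.  Restate-immune (no Theses import).
-/

noncomputable section

namespace Summit.QuantumFields.YangMills.BalabanUVNodes.N15.Gluing

open Real
open Literature.MathematicalPhysics.QuantumFieldTheory.Balaban1983to89
open Literature.MathematicalPhysics.QuantumFieldTheory.Balaban1983to89.B5Prop11Plancherel (Tor fine)
open Literature.MathematicalPhysics.QuantumFieldTheory.Balaban1983to89.B11SectG (BlockNorm HasMaj RowSum)
open Literature.MathematicalPhysics.QuantumFieldTheory.Balaban1983to89.B6RandomWalk (Triangle254)
open Literature.MathematicalPhysics.QuantumFieldTheory.Balaban1983to89.T4EtaRateCoeffDefect (pull diagK hasMaj_mulOp diagK_le_decay)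
open Literature.MathematicalPhysics.QuantumFieldTheory.Balaban1983to89.B6Prop26Gluing (mulOp mulOp_apply ind ind_nonneg ind_le_one)
open Literature.MathematicalPhysics.QuantumFieldTheory.Balaban1983to89.B6UnitTorusCarrier (unitTorusGeo triangle254_unitTorusGeo rowSum_unitTorusGeo unitTorusGeo_dist_nonneg
  unitTorusGeo_dist_self)
open Literature.MathematicalPhysics.QuantumFieldTheory.Balaban1983to89.B5SiteBridgeP12 (MP)
open Literature.MathematicalPhysics.QuantumFieldTheory.King1986.Torus (blockOf tdistT tdistT_nonneg)
open Summit.QuantumFields.YangMills.BalabanUVNodes.N15.VectorPiece (bshiftEquiv kingPrV blkFine)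
open Summit.QuantumFields.YangMills.BalabanUVNodes.N15.BackgroundLayer (fgrad bgrad symbOp_sD_eq)
open Summit.QuantumFields.YangMills.BalabanUVNodes.N15.TwoGrid (paramsOf deltaOp gOp neumannCubeG chiCube cubeBlocks landauRe qvRe qvAdjRe ineq110_114_pair hasMaj_gOp_of_ineq
  hasMaj_landauRe hasMaj_chiCube_symOp_comp hasMaj_comp_mulOp_chiInt hasMaj_chiCube_grad_neumannCubeG_fine hasMaj_chiCube_divAdjOut_neumannCubeG_pair hasMaj_chiCube_comp_neumannCubeG
  mulOp_comp_deltaOp_comp_neumannCubeG)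

variable {d : ℕ}

/-! ## §1 The partition multiplier's row, the entry-3 identity and its weighted row -/

section Weighted

variable {M : Fin (d + 1) → ℕ} [∀ μ, NeZero (M μ)] {L kk w q m₀ S : ℕ} [NeZero L] {n : ℕ} [NeZero n]

omit [NeZero L] in
/-- ★ the partition multiplier is two-sided localized on its cube: `M_{h_k} ≤ 1_□(y)1_□(y′)·e^{−δ|y−y′|_T}` (any real `δ`; diagonal kernel). [folklore] -/
theorem hasMaj_mulOp_coverH_loc (hM : ∀ ν, M ν = 2 * q * w) (hw : 0 < w) (hfit : m₀ + 2 * w + 1 ≤ S) (hS : S ≤ 2 * q * w) (k : Fin (d + 1) → ZMod (2 * q)) (δ : ℝ) :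
    HasMaj (BlockNorm.ofBlocks (unitTorusGeo L kk M) (fun b : Tor (fine n M) × Fin (d + 1) => blockOf n M b.1))
      (BlockNorm.ofBlocks (unitTorusGeo L kk M) (fun b : Tor (fine n M) × Fin (d + 1) => blockOf n M b.1)) (mulOp (hcube (2 * q) (coverXi M n w) k))
      (fun y y' => ind ((cubeBlocks M (coverCorner M w q m₀ k) S : Finset (Tor M)) : Set (Tor M)) y * ind ((cubeBlocks M (coverCorner M w q m₀ k) S : Finset (Tor M)) : Set (Tor M)) y' *
        (1 * Real.exp (-(δ * tdistT M y y')))) := by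
  have hχ := chiCube_coverCorner_eq_one_side (M := M) (n := n) (m₀ := m₀) hM hw hfit hS 0 k
  have h1 : ∀ x : Tor (fine n M) × Fin (d + 1), chiCube M n (coverCorner M w q m₀ k) S x ≠ 0 → blockOf n M x.1 ∈ ((cubeBlocks M (coverCorner M w q m₀ k) S : Finset (Tor M)) : Set (Tor M)) :=
    fun x hx => by
    unfold chiCube at hx
    by_contra hb
    exact hx (if_neg (fun hmem => hb (Finset.mem_coe.mpr hmem)))
  have hT : mulOp (chiCube M n (coverCorner M w q m₀ k) S) ∘ₗ mulOp (hcube (2 * q) (coverXi M n w) k) ∘ₗ mulOp (chiCube M n (coverCorner M w q m₀ k) S) =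
      mulOp (hcube (2 * q) (coverXi M n w) k) := by
    refine LinearMap.ext fun f => funext fun x => ?_
    simp only [LinearMap.comp_apply, mulOp_apply]
    by_cases h0 : hcube (2 * q) (coverXi M n w) k x = 0
    · rw [h0, zero_mul, zero_mul, mul_zero]
    · rw [chi_eq_one_of_hcube_ne_zero (2 * q) (coverXi M n w) (bshiftEquiv M n) 0 hχ (Or.inl rfl) h0, one_mul, one_mul]
  have hR : HasMaj (BlockNorm.ofBlocks (unitTorusGeo L kk M) (fun b : Tor (fine n M) × Fin (d + 1) => blockOf n M b.1))
      (BlockNorm.ofBlocks (unitTorusGeo L kk M) (fun b : Tor (fine n M) × Fin (d + 1) => blockOf n M b.1)) (mulOp (hcube (2 * q) (coverXi M n w) k))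
      (fun y y' => 1 * Real.exp (-(δ * tdistT M y y'))) := by
    refine (hasMaj_mulOp (g := unitTorusGeo L kk M) (fun b : Tor (fine n M) × Fin (d + 1) => blockOf n M b.1) (a := hcube (2 * q) (coverXi M n w) k) (m := fun _ => (1 : ℝ))
      (fun _ => zero_le_one) (fun x => abs_coverH_le_one k x)).mono fun y y' => ?_
    have h := diagK_le_decay (g := unitTorusGeo L kk M) (o := fun _ => (1 : ℝ)) (w := fun _ => (1 : ℝ)) (ε := 1) δ (fun _ => zero_le_one) (fun _ => by norm_num)
      (unitTorusGeo_dist_self L kk M) y y'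
    simpa using h
  exact hasMaj_localize_sandwich (g := unitTorusGeo L kk M) (fun b : Tor (fine n M) × Fin (d + 1) => blockOf n M b.1) (fun b : Tor (fine n M) × Fin (d + 1) => blockOf n M b.1)
    (fun y y' => mul_nonneg zero_le_one (Real.exp_nonneg _)) hT h1 h1 hR

/-- ★★ **THE ENTRY-3 IDENTITY**: `M_{h_k}∘(Σ∇*∇)∘G(□_k) = M_{h_k} − M_{h_k}∘(M_{χ_□}∘N_L∘G(□_k))` on the doubled torus (`M_ν = 2S`, `N_L = a•Q*Q − ∂Π∂*`): `Σ∇*∇ = Δ_a − N_L`, the exact per-cube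
locality `M_hΔ_aG(□) = M_h` (N-IIIa) and `M_h = M_hM_χ`. [cite: Balaban1984PropagatorsII, (2.37)–(2.38) p.229, (2.91) p.239] -/
theorem mulOp_coverH_comp_lapOp_comp_knitG (hM : ∀ ν, M ν = 2 * q * w) (hM2 : ∀ ν, M ν = 2 * S) (hw : 0 < w) (hfit : m₀ + 2 * w + 1 ≤ S) (hS : S ≤ 2 * q * w) {a : ℝ} (ha : 0 < a)
    (k : Fin (d + 1) → ZMod (2 * q)) :
    mulOp (hcube (2 * q) (coverXi M n w) k) ∘ₗ (lapOp (n : ℝ) (bshiftEquiv M n) 0 ∘ₗ neumannCubeG M n (coverCorner M w q m₀ k) S a) =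
      mulOp (hcube (2 * q) (coverXi M n w) k) -
        mulOp (hcube (2 * q) (coverXi M n w) k) ∘ₗ (mulOp (chiCube M n (coverCorner M w q m₀ k) S) ∘ₗ (a • (qvAdjRe M n ∘ₗ qvRe M n) + (-landauRe M n)) ∘ₗ
          neumannCubeG M n (coverCorner M w q m₀ k) S a) := by
  have hn : 1 ≤ n := Nat.one_le_iff_ne_zero.mpr (NeZero.ne n)
  have hlap : lapOp (n : ℝ) (bshiftEquiv M n) 0 = deltaOp M n a - (a • (qvAdjRe M n ∘ₗ qvRe M n) + (-landauRe M n)) :=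
    eq_sub_of_add_eq (deltaOp_eq_lapOp_zero_add (M := M) (n := n) a).symm
  have hloc := mulOp_comp_deltaOp_comp_neumannCubeG M n (coverCorner M w q m₀ k) S a hM2 hn ha
    (fun b hb => mem_intBonds_of_hcube_ne_zero_side (m₀ := m₀) hM hw hfit hS hb)
  have hcut := hcube_cut (2 * q) (coverXi M n w) (bshiftEquiv M n) 0 (chiCube_coverCorner_eq_one_side (M := M) (n := n) (m₀ := m₀) hM hw hfit hS 0 k)
  rw [hlap, LinearMap.sub_comp, LinearMap.comp_sub, hloc]
  congr 1
  rw [← LinearMap.comp_assoc ((a • (qvAdjRe M n ∘ₗ qvRe M n) + (-landauRe M n)) ∘ₗ neumannCubeG M n (coverCorner M w q m₀ k) S a)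
    (mulOp (chiCube M n (coverCorner M w q m₀ k) S)) (mulOp (hcube (2 * q) (coverXi M n w) k)), hcut]

omit [NeZero L] in
/-- ★★ **THE WEIGHTED ENTRY-3 ROW**: `M_{h_k}∘(Σ∇*∇)∘G(□_k) ≤ 1_□1_□·(1 + 2^{d+1}c_N(Ce^{δ₀})c_r)·e^{−ρd}` from the torus letters `G ≤ Ce^{−δ₀d}` (any spacing `n ≥ 1` of the doubled
torus) and `N_L ≤ c_Ne^{−ρ₁d}` with a row sum `c_r` at `σ`, `ρ ≤ δ₀`, `ρ + σ ≤ ρ₁` — §1's identity, FILE 47's localized multiplier, N-IIi `hasMaj_chiCube_comp_neumannCubeG`.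
[cite: Balaban1984PropagatorsII, (2.37) p.229, (2.133)–(2.134) p.247 (shapes); Balaban1984PropagatorsI, Prop. 1.2 (1.110) p.35, (1.126) p.38] -/
theorem hasMaj_mulOp_coverH_lap_knitG (hM : ∀ ν, M ν = 2 * q * w) (hM2 : ∀ ν, M ν = 2 * S) (hw : 0 < w) (hfit : m₀ + 2 * w + 1 ≤ S) (hS : S ≤ 2 * q * w) {a : ℝ} (ha : 0 < a)
    (k : Fin (d + 1) → ZMod (2 * q)) {C δ₀ cN ρ₁ ρ σ cr : ℝ} (hrow : RowSum (unitTorusGeo L kk M) σ cr) (hC : 0 ≤ C) (hδ₀ : 0 ≤ δ₀) (hcN : 0 ≤ cN) (hρ : 0 ≤ ρ) (hρδ : ρ ≤ δ₀)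
    (hρσ : ρ + σ ≤ ρ₁)
    (hG : HasMaj (BlockNorm.ofBlocks (unitTorusGeo L kk M) (fun b : Tor (fine n M) × Fin (d + 1) => blockOf n M b.1))
      (BlockNorm.ofBlocks (unitTorusGeo L kk M) (fun b : Tor (fine n M) × Fin (d + 1) => blockOf n M b.1)) (gOp M n a) (fun y y' => C * Real.exp (-(δ₀ * tdistT M y y'))))
    (hNL : HasMaj (BlockNorm.ofBlocks (unitTorusGeo L kk M) (fun b : Tor (fine n M) × Fin (d + 1) => blockOf n M b.1))
      (BlockNorm.ofBlocks (unitTorusGeo L kk M) (fun b : Tor (fine n M) × Fin (d + 1) => blockOf n M b.1)) (a • (qvAdjRe M n ∘ₗ qvRe M n) + (-landauRe M n))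
      (fun y y' => cN * Real.exp (-(ρ₁ * tdistT M y y')))) :
    HasMaj (BlockNorm.ofBlocks (unitTorusGeo L kk M) (fun b : Tor (fine n M) × Fin (d + 1) => blockOf n M b.1))
      (BlockNorm.ofBlocks (unitTorusGeo L kk M) (fun b : Tor (fine n M) × Fin (d + 1) => blockOf n M b.1))
      (mulOp (hcube (2 * q) (coverXi M n w) k) ∘ₗ (lapOp (n : ℝ) (bshiftEquiv M n) 0 ∘ₗ neumannCubeG M n (coverCorner M w q m₀ k) S a))
      (fun y y' => ind ((cubeBlocks M (coverCorner M w q m₀ k) S : Finset (Tor M)) : Set (Tor M)) y * ind ((cubeBlocks M (coverCorner M w q m₀ k) S : Finset (Tor M)) : Set (Tor M)) y' *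
        ((1 + 2 ^ (d + 1) * (cN * (C * Real.exp δ₀) * cr)) * Real.exp (-(ρ * tdistT M y y')))) := by
  have h1 := hasMaj_mulOp_coverH_loc (L := L) (kk := kk) (n := n) (m₀ := m₀) (S := S) hM hw hfit hS k ρ
  have hY := hasMaj_chiCube_comp_neumannCubeG (c := coverCorner M w q m₀ k) (S := S) (a := a) hM2 (triangle254_unitTorusGeo L kk M) hrow hC hδ₀ hcN hρ hρδ hρσ hNL hG
  have hMh := hasMaj_mulOp (g := unitTorusGeo L kk M) (fun b : Tor (fine n M) × Fin (d + 1) => blockOf n M b.1) (a := hcube (2 * q) (coverXi M n w) k) (m := fun _ => (1 : ℝ))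
    (fun _ => zero_le_one) (fun x => abs_coverH_le_one k x)
  have h2 := hasMaj_diag_comp (g := unitTorusGeo L kk M) (fun b : Tor (fine n M) × Fin (d + 1) => blockOf n M b.1) (fun _ => zero_le_one) hMh hY
  rw [mulOp_coverH_comp_lapOp_comp_knitG hM hM2 hw hfit hS ha k]
  refine (h1.sub h2).mono fun y y' => le_of_eq ?_
  ring

end Weighted

/-! ## §2 `(Σ∇′*∇′)∘G₀′` decays -/

section OneGrid

variable {L : ℕ} [NeZero L]

/-- ★★★ **ENTRY 3 OF THE COVER's PARAMETRIX ON THE DOUBLED TORUS, FINE MEMBER**: for odd `L ≥ 3`, `a > 0` there are `δ, A > 0` (uniform in `m, k, r`) with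
`(Σ_μ∇′*_μ∇′_μ)∘G₀′ ≤ A·e^{−δ|y−y′|_T}` at the fine spacing `L^r·L^k` (blocks read through King's pairing), `k ≥ 1` — FILE 83 `hasMaj_comp_parametrix_of_commOp_h` with §1's weighted rows
and FILE 72's commutator rows on dag-n15-a's fine cut rows. [cite: Balaban1984PropagatorsII, (2.133), (2.136) p.247 (shapes + mechanism), (2.36)–(2.38) p.229; Balaban1985BackgroundPropagators,
(3.42) p.397 (entry 3: shape); Balaban1984PropagatorsI, Prop. 1.2 (1.110) p.35, (1.126) p.38] -/
theorem hasMaj_lap_parametrix_knit (hL : Odd L ∧ 1 < L) {a : ℝ} (ha : 0 < a) :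
    ∃ δ A : ℝ, 0 < δ ∧ 0 < A ∧ ∀ (m kk r : ℕ) (_hk : 1 ≤ kk),
      HasMaj (BlockNorm.ofBlocks (unitTorusGeo L kk (MP (paramsOf d L (m + 1) kk hL)))
          (fun i : Tor (fine (L ^ r * L ^ kk) (MP (paramsOf d L (m + 1) kk hL))) × Fin (d + 1) => blockOf (L ^ r * L ^ kk) (MP (paramsOf d L (m + 1) kk hL)) i.1))
        (BlockNorm.ofBlocks (unitTorusGeo L kk (MP (paramsOf d L (m + 1) kk hL)))
          (fun i : Tor (fine (L ^ r * L ^ kk) (MP (paramsOf d L (m + 1) kk hL))) × Fin (d + 1) => blockOf (L ^ r * L ^ kk) (MP (paramsOf d L (m + 1) kk hL)) i.1))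
        (lapOp ((L ^ r * L ^ kk : ℕ) : ℝ) (bshiftEquiv (MP (paramsOf d L (m + 1) kk hL)) (L ^ r * L ^ kk)) 0 ∘ₗ
          parametrix (knitH d L m kk (L ^ r * L ^ kk) hL) (knitG d L m kk (L ^ r * L ^ kk) hL a))
        (fun y y' => A * Real.exp (-(δ * tdistT (MP (paramsOf d L (m + 1) kk hL)) y y'))) := by
  have hL3 : 3 ≤ L := by obtain ⟨⟨j, hj⟩, h1⟩ := hL; omega
  have hLpos : 0 < L := by omega
  obtain ⟨δ₀, C, Cα, Cε, Cαε, hδ₀, hC, H⟩ := ineq110_114_pair (d := d) hL ha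
  obtain ⟨δ₁, C₁, hδ₁, hC₁, HL⟩ := hasMaj_landauRe (d := d) (L := L)
  obtain ⟨δD, βD, hδD, hβD, HD⟩ := hasMaj_chiCube_grad_neumannCubeG_fine (d := d) hL ha
  obtain ⟨δB, βB, hδB, hβB, HB⟩ := hasMaj_chiCube_divAdjOut_neumannCubeG_pair (d := d) hL ha
  set δm : ℝ := min δ₀ δ₁ with hδm_def
  have hδm : 0 < δm := lt_min hδ₀ hδ₁
  set δ : ℝ := min (δm / 2) (min δD δB) with hδ_def
  have hδ : 0 < δ := lt_min (by positivity) (lt_min hδD hδB)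
  have hd0 : δ ≤ δ₀ := (min_le_left _ _).trans (by linarith [min_le_left δ₀ δ₁])
  have hdm : δ ≤ δm / 2 := min_le_left _ _
  have hdD : δ ≤ δD := (min_le_right _ _).trans (min_le_left _ _)
  have hdB : δ ≤ δB := (min_le_right _ _).trans (min_le_right _ _)
  set cr : ℝ := B4Sect5Proof.latticeConst (d + 1) (δm / 4) with hcr_def
  have hcr : 0 ≤ cr := B4Sect5Proof.latticeConst_nonneg (d + 1) (by positivity)
  set β : ℝ := 2 ^ (d + 1) * (C * Real.exp δ₀) with hβ_def
  have hβ : 0 ≤ β := by positivity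
  set β₁ : ℝ := max βD βB with hβ₁_def
  have hβ₁ : 0 ≤ β₁ := hβD.le.trans (le_max_left _ _)
  set cN : ℝ := |a| * (Real.exp δm * Real.exp δm) + C₁ with hcN_def
  have hcN : 0 ≤ cN := by positivity
  set β₃ : ℝ := 1 + 2 ^ (d + 1) * (cN * (C * Real.exp δ₀) * cr) with hβ₃_def
  have hβ₃ : 0 ≤ β₃ := by positivity
  set Θ : ℝ := (d + 1 : ℕ) * (32 * π ^ 2 * β + 2 * (π * β₁)) with hΘ_def
  have hΘ : 0 ≤ Θ := by positivity
  set Nov : ℝ := (((2 * L) ^ (d + 1) : ℕ) : ℝ) with hNov_def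
  refine ⟨δ, Nov * (β₃ + Θ) + 1, hδ, by positivity, fun m kk r hk => ?_⟩
  set M : Fin (d + 1) → ℕ := MP (paramsOf d L (m + 1) kk hL) with hMdef
  have hM : ∀ ν, M ν = 2 * L * L ^ m := MP_succ_eq L m kk hL
  have hM' : ∀ ν, M ν = 2 * (L * L ^ m) := fun ν => by rw [hM ν, mul_assoc]
  have hw : 0 < L ^ m := pow_pos hLpos m
  have hn' : 1 ≤ L ^ r * L ^ kk := Nat.one_le_iff_ne_zero.mpr (Nat.mul_ne_zero (pow_ne_zero r (NeZero.ne L)) (pow_ne_zero kk (NeZero.ne L)))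
  have hfit := coverMargin_fit hL3 m
  have hfit1 : coverMargin L m + 2 * L ^ m + 1 ≤ L * L ^ m := by omega
  have hS : L * L ^ m ≤ 2 * L * L ^ m := by rw [mul_assoc]; omega
  have hSe : L ^ (m + 1) = L * L ^ m := by rw [pow_succ, mul_comm]
  have hwR : (1 : ℝ) ≤ ((L ^ m : ℕ) : ℝ) := by exact_mod_cast hw
  have hwpos : (0 : ℝ) < ((L ^ m : ℕ) : ℝ) := by linarith
  have hrow := rowSum_unitTorusGeo (L := L) (k := kk) (M := M) (σ := δm / 4) (by positivity)
  have hind : ∀ (k : Fin (d + 1) → ZMod (2 * L)) (y y' : Tor M),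
      0 ≤ ind (g := unitTorusGeo L kk M) ((cubeBlocks M (coverCorner M (L ^ m) L (coverMargin L m) k) (L * L ^ m) : Finset (Tor M)) : Set (Tor M)) y *
        ind (g := unitTorusGeo L kk M) ((cubeBlocks M (coverCorner M (L ^ m) L (coverMargin L m) k) (L * L ^ m) : Finset (Tor M)) : Set (Tor M)) y' :=
    fun k y y' => mul_nonneg (ind_nonneg _ _) (ind_nonneg _ _)
  -- torus letters at the fine spacing
  have hG' := hasMaj_gOp_of_ineq (L := L) (k := kk) M (L ^ r * L ^ kk) a hn' (H (m + 1) kk r hk).2 hC.le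
  have hNL' := hasMaj_nonlocalPart (L := L) (kk := kk) (M := M) (n := L ^ r * L ^ kk) (a := a) hC₁.le hδm.le (min_le_right δ₀ δ₁) (HL kk (L ^ r * L ^ kk) M)
  -- the weighted entry-3 rows (§1), rate `δm ∕ 2`, weakened to `δ`
  have hE3 : ∀ k : Fin (d + 1) → ZMod (2 * L),
      HasMaj (BlockNorm.ofBlocks (unitTorusGeo L kk M) (fun i : Tor (fine (L ^ r * L ^ kk) M) × Fin (d + 1) => blockOf (L ^ r * L ^ kk) M i.1))
        (BlockNorm.ofBlocks (unitTorusGeo L kk M) (fun i : Tor (fine (L ^ r * L ^ kk) M) × Fin (d + 1) => blockOf (L ^ r * L ^ kk) M i.1))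
        (mulOp (knitH d L m kk (L ^ r * L ^ kk) hL k) ∘ₗ (lapOp ((L ^ r * L ^ kk : ℕ) : ℝ) (bshiftEquiv M (L ^ r * L ^ kk)) 0 ∘ₗ knitG d L m kk (L ^ r * L ^ kk) hL a k))
        (fun y y' => ind ((cubeBlocks M (coverCorner M (L ^ m) L (coverMargin L m) k) (L * L ^ m) : Finset (Tor M)) : Set (Tor M)) y *
          ind ((cubeBlocks M (coverCorner M (L ^ m) L (coverMargin L m) k) (L * L ^ m) : Finset (Tor M)) : Set (Tor M)) y' * (β₃ * Real.exp (-(δ * tdistT M y y')))) := fun k =>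
    hasMaj_rate_le (hind k) hβ₃ hdm
      (hasMaj_mulOp_coverH_lap_knitG (L := L) (kk := kk) (n := L ^ r * L ^ kk) (m₀ := coverMargin L m) hM hM' hw hfit1 hS ha k hrow hC.le hδ₀.le hcN
        (by positivity : 0 ≤ δm / 2) (by linarith [min_le_left δ₀ δ₁] : δm / 2 ≤ δ₀) (by linarith : δm / 2 + δm / 4 ≤ δm) hG' hNL')
  -- the fine cut rows for the commutator, common rate `δ`
  have hGc' : ∀ k : Fin (d + 1) → ZMod (2 * L),
      HasMaj (BlockNorm.ofBlocks (unitTorusGeo L kk M) (fun i : Tor (fine (L ^ r * L ^ kk) M) × Fin (d + 1) => blockOf (L ^ r * L ^ kk) M i.1))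
        (BlockNorm.ofBlocks (unitTorusGeo L kk M) (fun i : Tor (fine (L ^ r * L ^ kk) M) × Fin (d + 1) => blockOf (L ^ r * L ^ kk) M i.1))
        (mulOp (chiCube M (L ^ r * L ^ kk) (coverCorner M (L ^ m) L (coverMargin L m) k) (L * L ^ m)) ∘ₗ knitG d L m kk (L ^ r * L ^ kk) hL a k)
        (fun y y' => ind ((cubeBlocks M (coverCorner M (L ^ m) L (coverMargin L m) k) (L * L ^ m) : Finset (Tor M)) : Set (Tor M)) y *
          ind ((cubeBlocks M (coverCorner M (L ^ m) L (coverMargin L m) k) (L * L ^ m) : Finset (Tor M)) : Set (Tor M)) y' * (β * Real.exp (-(δ * tdistT M y y')))) := fun k =>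
    hasMaj_rate_le (hind k) hβ hd0
      (hasMaj_chiCube_symOp_comp (L := L) (k := kk) (c := coverCorner M (L ^ m) L (coverMargin L m) k) (S := L * L ^ m) hC.le hδ₀.le hM'
        (hasMaj_comp_mulOp_chiInt (c := coverCorner M (L ^ m) L (coverMargin L m) k) (S := L * L ^ m) hC.le hG'))
  have hDc' : ∀ (k : Fin (d + 1) → ZMod (2 * L)) (μ : Fin (d + 1)),
      HasMaj (BlockNorm.ofBlocks (unitTorusGeo L kk M) (fun i : Tor (fine (L ^ r * L ^ kk) M) × Fin (d + 1) => blockOf (L ^ r * L ^ kk) M i.1))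
        (BlockNorm.ofBlocks (unitTorusGeo L kk M) (fun i : Tor (fine (L ^ r * L ^ kk) M) × Fin (d + 1) => blockOf (L ^ r * L ^ kk) M i.1))
        (mulOp (chiCube M (L ^ r * L ^ kk) (coverCorner M (L ^ m) L (coverMargin L m) k) (L * L ^ m)) ∘ₗ
          (fgrad ((L ^ r * L ^ kk : ℕ) : ℝ) (bshiftEquiv M (L ^ r * L ^ kk) μ) ∘ₗ knitG d L m kk (L ^ r * L ^ kk) hL a k))
        (fun y y' => ind ((cubeBlocks M (coverCorner M (L ^ m) L (coverMargin L m) k) (L * L ^ m) : Finset (Tor M)) : Set (Tor M)) y *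
          ind ((cubeBlocks M (coverCorner M (L ^ m) L (coverMargin L m) k) (L * L ^ m) : Finset (Tor M)) : Set (Tor M)) y' * (β₁ * Real.exp (-(δ * tdistT M y y')))) :=
    fun k μ => by
    have h := HD (m + 1) kk r hk (coverCorner M (L ^ m) L (coverMargin L m) k) μ
    rw [hSe, symbOp_sD_eq] at h
    exact (hasMaj_rate_le (hind k) hβD.le hdD h).mono fun y y' =>
      mul_le_mul_of_nonneg_left (mul_le_mul_of_nonneg_right (le_max_left _ _) (Real.exp_nonneg _)) (hind k y y')
  have hDbc' : ∀ (k : Fin (d + 1) → ZMod (2 * L)) (μ : Fin (d + 1)),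
      HasMaj (BlockNorm.ofBlocks (unitTorusGeo L kk M) (fun i : Tor (fine (L ^ r * L ^ kk) M) × Fin (d + 1) => blockOf (L ^ r * L ^ kk) M i.1))
        (BlockNorm.ofBlocks (unitTorusGeo L kk M) (fun i : Tor (fine (L ^ r * L ^ kk) M) × Fin (d + 1) => blockOf (L ^ r * L ^ kk) M i.1))
        (mulOp (chiCube M (L ^ r * L ^ kk) (coverCorner M (L ^ m) L (coverMargin L m) k) (L * L ^ m)) ∘ₗ
          (bgrad ((L ^ r * L ^ kk : ℕ) : ℝ) (bshiftEquiv M (L ^ r * L ^ kk) μ) ∘ₗ knitG d L m kk (L ^ r * L ^ kk) hL a k))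
        (fun y y' => ind ((cubeBlocks M (coverCorner M (L ^ m) L (coverMargin L m) k) (L * L ^ m) : Finset (Tor M)) : Set (Tor M)) y *
          ind ((cubeBlocks M (coverCorner M (L ^ m) L (coverMargin L m) k) (L * L ^ m) : Finset (Tor M)) : Set (Tor M)) y' * (β₁ * Real.exp (-(δ * tdistT M y y')))) :=
    fun k μ => by
    have h := (HB (m + 1) kk r hk (coverCorner M (L ^ m) L (coverMargin L m) k) μ).2
    rw [hSe] at h
    rw [bgrad_eq_neg_symbOp, LinearMap.neg_comp, LinearMap.comp_neg]
    exact ((hasMaj_rate_le (hind k) hβB.le hdB h).mono fun y y' =>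
      mul_le_mul_of_nonneg_left (mul_le_mul_of_nonneg_right (le_max_right _ _) (Real.exp_nonneg _)) (hind k y y')).neg
  have hKc' : ∀ k : Fin (d + 1) → ZMod (2 * L),
      HasMaj (BlockNorm.ofBlocks (unitTorusGeo L kk M) (fun i : Tor (fine (L ^ r * L ^ kk) M) × Fin (d + 1) => blockOf (L ^ r * L ^ kk) M i.1))
        (BlockNorm.ofBlocks (unitTorusGeo L kk M) (fun i : Tor (fine (L ^ r * L ^ kk) M) × Fin (d + 1) => blockOf (L ^ r * L ^ kk) M i.1))
        (commOp (lapOp ((L ^ r * L ^ kk : ℕ) : ℝ) (bshiftEquiv M (L ^ r * L ^ kk)) 0) (knitH d L m kk (L ^ r * L ^ kk) hL k) ∘ₗ knitG d L m kk (L ^ r * L ^ kk) hL a k)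
        (fun y y' => ind ((cubeBlocks M (coverCorner M (L ^ m) L (coverMargin L m) k) (L * L ^ m) : Finset (Tor M)) : Set (Tor M)) y *
          ind ((cubeBlocks M (coverCorner M (L ^ m) L (coverMargin L m) k) (L * L ^ m) : Finset (Tor M)) : Set (Tor M)) y' * (Θ * Real.exp (-(δ * tdistT M y y')))) := fun k => by
    have h := hasMaj_commOp_lapOp_comp_cover_of (L := L) (kk := kk) (M := M) (n := L ^ r * L ^ kk) hM hw hfit1 hS k (hGc' k) (hDc' k) (hDbc' k)
    refine h.mono fun y y' => mul_le_mul_of_nonneg_left (mul_le_mul_of_nonneg_right ?_ (Real.exp_nonneg _)) (hind k y y')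
    have h32 : 32 * π ^ 2 / ((L ^ m : ℕ) : ℝ) ^ 2 * β ≤ 32 * π ^ 2 * β := by
      refine mul_le_mul_of_nonneg_right (div_le_self (by positivity) ?_) hβ
      nlinarith
    have hπ : π / ((L ^ m : ℕ) : ℝ) * β₁ ≤ π * β₁ := mul_le_mul_of_nonneg_right (div_le_self Real.pi_pos.le hwR) hβ₁
    rw [hΘ_def, add_zero]
    exact mul_le_mul_of_nonneg_left (by linarith) (by positivity)
  have hh : ∀ (k : Fin (d + 1) → ZMod (2 * L)) x, |knitH d L m kk (L ^ r * L ^ kk) hL k x| ≤ 1 := fun k x => abs_coverH_le_one k x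
  have hN := fun y => sum_ind_cubeBlocks_le (M := M) (w := L ^ m) (q := L) (m₀ := coverMargin L m) L kk y
  -- FILE 83
  have key := hasMaj_comp_parametrix_of_commOp_h (g := unitTorusGeo L kk M) (fun i : Tor (fine (L ^ r * L ^ kk) M) × Fin (d + 1) => blockOf (L ^ r * L ^ kk) M i.1)
    (fun k => ((cubeBlocks M (coverCorner M (L ^ m) L (coverMargin L m) k) (L * L ^ m) : Finset (Tor M)) : Set (Tor M))) hβ₃ hΘ hh hN hE3 hKc'
  refine key.mono fun y y' => mul_le_mul_of_nonneg_right (by linarith [mul_nonneg (by positivity : (0 : ℝ) ≤ Nov) (add_nonneg hβ₃ hΘ)]) (Real.exp_nonneg _)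

end OneGrid

end Summit.QuantumFields.YangMills.BalabanUVNodes.N15.Gluing

end
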